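import Mathlib.Analysis.Complex.Basic
import Mathlib.Order.Filter.Cofinite
import Mathlib.Algebra.BigOperators.Finprod
import Mathlib.SetTheory.Cardinal.Finite
import HarnessLib

/-!
# Kaletha–Mínguez–Shin–White (2014), «Endoscopic classification of representations: inner forms of unitary groups» —
# §1.7 the main global theorem (Theorem* 1.7.1), the two hypotheses it is proved under (Hypothesis 3.6.3, the local
# intertwining relation Theorem* 2.6.2) and the Chapter-5 theorem (Theorem 5.0.5), as named predicates on an explicit interface

T. Kaletha, A. Mínguez, S. W. Shin, P.-J. White, arXiv:1409.3731 [KalethaMinguezShinWhite2014] — a PREPRINT (unrefereed; the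
tree tags it `[claim: …, under-review]`, as ★ `Mok2015/DependencyDag`, ★ `Arthur2013/Downstream5` do); text held as
`paper:arxiv-1409.3731` (TeX-derived, 124 chunks; its own chapter numbering is print + 1: held «2.7 Main global theorem»,
«Theorem* 2.7.1», «Hypothesis 4.6.3», «Theorem* 3.6.2», «Theorem 6.0.5» = print §1.7, Theorem* 1.7.1, Hypothesis 3.6.3,
Theorem* 2.6.2, Theorem 5.0.5 — pins below are PRINT numbers with the held chunk).  Squad TN (HCML «GO 500», DEAL v5 ② G15);
topic `NumberTheory/Automorphic/KalethaMinguezShinWhite2014`, namespace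
`Literature.NumberTheory.Automorphic.KalethaMinguezShinWhite2014.MainTheorems`.  STATEMENTS ONLY: every `def`/`structure` has a
body; no theorem, no `sorry`, no `axiom`, no `instance`, no `notation`.

## What is printed (§1.7, chunk p0045–p0046; Ch. 5, chunk p0117)
For an inner twist `(G, ξ)` of `G* = U_{E/F}(N)` (`E/F` quadratic extension of number fields), `κ ∈ {±1}`, `χ_κ ∈ 𝒵_E^κ`: for
`ψ ∈ Ψ(G*, η_{χ_κ})` with localizations `ψ_v`, local packets `Π_{ψ_v}(G_v, ξ_v)` with maps `π_v ↦ ⟨·, π_v⟩_{ξ_v,z_v}` into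
`Irr(S^♮_ψ, χ_z)` (Theorem* 1.6.1), «Define the global packet for `ψ` by
`Π_ψ(G, ξ) := {⊗_v π_v : π_v ∈ Π_{ψ_v}(G_v, ξ_v), ⟨·, π_v⟩_{ξ_v,z_v} = 1 for almost all v}` … To each `π = ⊗_v π_v ∈ Π_ψ(G, ξ)` we
attach a character on `S^♮_ψ` by `⟨s, π⟩_ξ := ∏_v ⟨s, π_v⟩_{ξ_v,z_v}` … the character `ε_ψ : S̄_ψ → {±1}` … `ε_ψ = 1` identically if
`ψ` is generic … `Π_ψ(G, ξ, ε_ψ) := {π ∈ Π_ψ(G, ξ) : ⟨·, π⟩_ξ = ε_ψ}`.»  **Theorem* 1.7.1.** «Let `E/F` be a quadratic extension of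
global fields and `κ ∈ {±1}`. Fix `χ_κ ∈ 𝒵^κ_E`. Let `(G, ξ)` be an inner twist of `G* = U_{E/F}(N)`. Then there is a
`G(𝔸_F)`-module isomorphism `L²_disc(G(F)\G(𝔸_F)) ≃ ⊕_{ψ ∈ Ψ₂(G*, η_{χ_κ})} ⊕_{π ∈ Π_ψ(G, ξ, ε_ψ)} π`.»  Status printed
there: «Theorem 1.7.1 will be completely proved in [KMS_A] if `(G, ξ)` is realized as a pure inner twist and in [KMS_B] in
general. More precisely we prove the theorem in Chapter 5 under two hypotheses, which are resolved in [KMS_A] and [KMS_B] … The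
unconditional result of this paper towards the theorem, is a natural decomposition of `L²_disc` according to the parameters
`ψ` only when `ψ` is generic and `(G, ξ)` comes from a pure inner twist, in which case the two hypotheses are verified.»
Ch. 5: «Recall from §3.3 that `L²_disc(G(F)\G(𝔸_F)) = ⊕_ψ L²_{disc,ψ}` as `ψ` runs over `Ψ(G*, η_χ)` … We assume the following
on `ψ`: • Hypothesis 3.6.3 (i.e. the local classification theorem holds for `ψ_v` at every `v`) and • Theorem 2.6.2 (the local
intertwining relation) for `ψ_v` at every place `v`. These have been established if `ψ = φ` is generic and if `(G, ξ)` is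
realized as a pure inner twist of `G*`.  **Theorem 5.0.5.** Let `ψ ∈ Ψ(G*, η_χ)`. Under the two assumptions above, (1)
`L²_{disc,ψ} = 0` if `ψ ∉ Ψ₂(G*, η_χ)`. (2) `L²_{disc,ψ} = ⊕_{π ∈ Π_ψ(G, ξ, ε_ψ)} π` if `ψ ∈ Ψ₂(G*, η_χ)`.»

## How it is typed (as-printed predicates on an explicit interface — squad policy; precedent ★ `LanglandsShelstad1987/Properties`)
None of: global∕local A-parameters of unitary groups, the groups `S^♮_ψ`, local A-packets, `L²_disc(G(F)\G(𝔸_F))` as a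
`G(𝔸_F)`-module, the intertwining relation — exists in Mathlib or in the tree (the ★ `Arthur2013/…`, ★ `Mok2015/…` files are a
BIBLIOGRAPHIC dependency ledger of these claims, not their mathematics; census `T/LNS/TN-t02/g0/CENSUS-KMSW2014-1.7.1.md`).  So
`GlobalDatum` records, for ONE `(G, ξ, χ_κ)`, the printed carriers as data: the parameter set with its «discrete» and «generic»
predicates, the places, the unitary duals `Π_unit(G_v)`, the groups `S^♮_ψ → S^♮_{ψ_v}`, the local packets with their members'
representations and characters, `ε_ψ`, the multiplicity of an irreducible `π = ⊗_v π_v` in `L²_disc` and in each `ψ`-part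
`L²_{disc,ψ}` (an isomorphism `L²_{disc(,ψ)} ≃ ⊕ π` of `G(𝔸_F)`-modules with a direct sum of irreducibles is recorded through
these multiplicities), and the two hypotheses as `Prop`s.  On it the printed DEFINITIONS (`globalPacket`, `globalPair`,
`globalPacketEps`) are real `def`s and the printed ASSERTIONS are `def … : Prop` predicates; a consumer asserts them for ITS
datum (e.g. the socket ★ `Cruxes/HLiu418/Lines/F0_P5_CurveThetaLettersPaydown` `stub_glob_multLeOneAtThetaHol`, third pin);
`∀ D` is never claimed.  Irreducible representations of `G(𝔸_F)` are modelled as families `(π_v)_v` of members of the unitary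
duals (restricted tensor products; the restrictedness of an automorphic `π` is part of the consumer's `mdisc`).

## Index (print item ↦ declaration; p = as-printed predicate, d = definition)
§1.7 carriers `GlobalDatum` (d); `Π_ψ(G,ξ)` = `globalPacket` (d); `⟨s,π⟩_ξ` = `globalPair` (d); `Π_ψ(G,ξ,ε_ψ)` = `globalPacketEps` (d);
the representation `⊗_v π_v` of a member = `memberRep` (d); «`ε_ψ = 1` if `ψ` generic» = `Par_1_7_epsGeneric` (p); §3.3
`L²_disc = ⊕_ψ L²_{disc,ψ}` = `Par_3_3_psiDecomposition` (p); Theorem 5.0.5 = `Theorem_5_0_5` (p); «these have been established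
if ψ generic and (G,ξ) pure inner» = `Par_5_hypothesesVerified` (p); Theorem* 1.7.1 = `Theorem_1_7_1` (p); its unconditional part
= `Theorem_1_7_1_genericPure` (p).  Not typed: Remark 1.7.2 (needs «everywhere tempered»), the independence of `κ, χ_κ, z`
(Lemma 1.3.x), the product-formula descent of `⟨·,π⟩_ξ` to `S̄_ψ` — census lines only.
-/

noncomputable section

namespace Literature.NumberTheory.Automorphic.KalethaMinguezShinWhite2014.MainTheorems

universe u

/-- **The carriers of §1.7** for one inner twist `(G, ξ)` of `G* = U_{E/F}(N)` with `κ`, `χ_κ` fixed (chunk p0045–p0046; Ch. 5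
p0117), as explicit data — see the module docstring for what each field stands for in print.  Nothing is asserted about them
here. [claim: KalethaMinguezShinWhite2014, under-review] -/
structure GlobalDatum where
  /-- `Ψ(G*, η_{χ_κ})`: the global parameters (§1.3.4). -/
  Param : Type u
  /-- `ψ ∈ Ψ₂(G*, η_{χ_κ})` (discrete = square-integrable parameters). -/
  IsDiscrete : Param → Prop
  /-- `ψ` is generic (`ψ = φ`, trivial `SL₂`-factor). -/
  IsGeneric : Param → Prop
  /-- The places `v` of `F`. -/
  Place : Type u
  /-- `Π_unit(G_v)`: (isomorphism classes of) irreducible unitary representations of `G_v = G(F_v)`. -/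
  LocRep : Place → Type u
  /-- `S^♮_ψ` (global centralizer quotient, §1.3). -/
  Sglob : Param → Type u
  /-- `S^♮_{ψ_v}` for the localization `ψ_v` (§1.3.5). -/
  Sloc : Place → Param → Type u
  /-- The localization map `S^♮_ψ → S^♮_{ψ_v}`. -/
  locMap : (v : Place) → (ψ : Param) → Sglob ψ → Sloc v ψ
  /-- `Π_{ψ_v}(G_v, ξ_v)`: the local packet (a finite set; Theorem* 1.6.1 (1)). -/
  LocPkt : Place → Param → Type u
  /-- The map `Π_{ψ_v}(G_v, ξ_v) → Π_unit(G_v)` (Theorem* 1.6.1 (1)). -/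
  locRep : (v : Place) → (ψ : Param) → LocPkt v ψ → LocRep v
  /-- `π_v ↦ ⟨·, π_v⟩_{ξ_v, z_v}`, a character of `S^♮_{ψ_v}` (Theorem* 1.6.1 (2)), as a function into `ℂ^×`. -/
  locPair : (v : Place) → (ψ : Param) → LocPkt v ψ → Sloc v ψ → ℂˣ
  /-- `ε_ψ : S̄_ψ → {±1}` pulled back to `S^♮_ψ` ([Mok], cf. [Arthur]; §1.7). -/
  eps : (ψ : Param) → Sglob ψ → ℂˣ
  /-- The multiplicity of the irreducible `π = ⊗_v π_v` in `L²_disc(G(F)\G(𝔸_F))`. -/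
  mdisc : ((v : Place) → LocRep v) → ℕ
  /-- The multiplicity of `π` in the `ψ`-part `L²_{disc,ψ}(G(F)\G(𝔸_F))` (§3.3). -/
  mdiscPsi : Param → ((v : Place) → LocRep v) → ℕ
  /-- Hypothesis 3.6.3 `Hyp(ψ)`: «The local classification theorem for `ψ_v` is proven for every `v`». -/
  HypLocal : Param → Prop
  /-- Theorem* 2.6.2 (the local intertwining relation) «for `ψ_v` at every place `v`». -/
  HypLIR : Param → Prop
  /-- «`(G, ξ)` is realized as a pure inner twist of `G*`». -/
  IsPureInner : Prop

namespace GlobalDatum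

variable (D : GlobalDatum.{u})

/-- **`Π_ψ(G, ξ) := {⊗_v π_v : π_v ∈ Π_{ψ_v}(G_v, ξ_v), ⟨·, π_v⟩_{ξ_v,z_v} = 1 for almost all v}`** (§1.7, chunk p0045), as the
set of families of local packet members whose character is trivial off a finite set of places.
[claim: KalethaMinguezShinWhite2014, under-review] -/
def globalPacket (ψ : D.Param) : Set ((v : D.Place) → D.LocPkt v ψ) :=
  {p | ∀ᶠ v in Filter.cofinite, ∀ s : D.Sloc v ψ, D.locPair v ψ (p v) s = 1}

/-- **`⟨s, π⟩_ξ := ∏_v ⟨s, π_v⟩_{ξ_v,z_v}`, `s ∈ S^♮_ψ`** (§1.7, chunk p0046), «where the latter `s` denotes the image of `s` under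
`S^♮_ψ → S^♮_{ψ_v}`»; a `finprod` (the printed product is finite on `Π_ψ(G, ξ)`).
[claim: KalethaMinguezShinWhite2014, under-review] -/
def globalPair (ψ : D.Param) (p : (v : D.Place) → D.LocPkt v ψ) (s : D.Sglob ψ) : ℂˣ :=
  ∏ᶠ v, D.locPair v ψ (p v) (D.locMap v ψ s)

/-- **`Π_ψ(G, ξ, ε_ψ) := {π ∈ Π_ψ(G, ξ) : ⟨·, π⟩_ξ = ε_ψ}`** (§1.7, chunk p0046). [claim: KalethaMinguezShinWhite2014, under-review] -/
def globalPacketEps (ψ : D.Param) : Set ((v : D.Place) → D.LocPkt v ψ) :=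
  {p | p ∈ D.globalPacket ψ ∧ ∀ s : D.Sglob ψ, D.globalPair ψ p s = D.eps ψ s}

/-- The representation `π = ⊗_v π_v` of `G(𝔸_F)` underlying a family of local packet members (§1.7: «`⊗_v π_v : π_v ∈
Π_{ψ_v}(G_v, ξ_v)`», through Theorem* 1.6.1 (1) `Π_{ψ_v}(G_v,ξ_v) → Π_unit(G_v)`). [claim: KalethaMinguezShinWhite2014, under-review] -/
def memberRep (ψ : D.Param) (p : (v : D.Place) → D.LocPkt v ψ) : (v : D.Place) → D.LocRep v :=
  fun v => D.locRep v ψ (p v)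

/-- The number of members of `Π_ψ(G, ξ, ε_ψ)` whose representation is `π` — the multiplicity of `π` in `⊕_{π′ ∈ Π_ψ(G,ξ,ε_ψ)} π′`
(Theorem* 1.7.1, Theorem 5.0.5 (2)); `Nat.card`, i.e. the junk value `0` if infinite (never the case in print: local packets are
finite and almost all components are pinned). [claim: KalethaMinguezShinWhite2014, under-review] -/
def packetMultiplicity (ψ : D.Param) (π : (v : D.Place) → D.LocRep v) : ℕ :=
  Nat.card {p : (v : D.Place) → D.LocPkt v ψ // p ∈ D.globalPacketEps ψ ∧ D.memberRep ψ p = π}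

/-- §1.7 (chunk p0046): «we … simply note that `ε_ψ = 1` identically if `ψ` is generic».
[claim: KalethaMinguezShinWhite2014, under-review] -/
def Par_1_7_epsGeneric : Prop := ∀ ψ : D.Param, D.IsGeneric ψ → ∀ s : D.Sglob ψ, D.eps ψ s = 1

/-- §3.3 (recalled in Ch. 5, chunk p0117): «`L²_disc(G(F)\G(𝔸_F)) = ⊕_ψ L²_{disc,ψ}(G(F)\G(𝔸_F))` as `ψ` runs over `Ψ(G*, η_χ)`»
— in multiplicities: `m_disc(π) = Σ_ψ m_{disc,ψ}(π)` (a `finsum`; finitely many `ψ` contribute for a given `π`).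
[claim: KalethaMinguezShinWhite2014, under-review] -/
def Par_3_3_psiDecomposition : Prop :=
  ∀ π : (v : D.Place) → D.LocRep v, D.mdisc π = ∑ᶠ ψ : D.Param, D.mdiscPsi ψ π

/-- **Theorem 5.0.5** (Ch. 5, chunk p0117): «Let `ψ ∈ Ψ(G*, η_χ)`. Under the two assumptions above [Hypothesis 3.6.3 and Theorem*
2.6.2 for `ψ_v` at every `v`], (1) `L²_{disc,ψ}(G(F)\G(𝔸_F)) = 0` if `ψ ∉ Ψ₂(G*, η_χ)`. (2)
`L²_{disc,ψ}(G(F)\G(𝔸_F)) = ⊕_{π ∈ Π_ψ(G, ξ, ε_ψ)} π` if `ψ ∈ Ψ₂(G*, η_χ)`.» — in multiplicities.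
[claim: KalethaMinguezShinWhite2014, under-review] -/
def Theorem_5_0_5 (ψ : D.Param) : Prop :=
  D.HypLocal ψ → D.HypLIR ψ →
    (¬ D.IsDiscrete ψ → ∀ π, D.mdiscPsi ψ π = 0) ∧
      (D.IsDiscrete ψ → ∀ π, D.mdiscPsi ψ π = D.packetMultiplicity ψ π)

/-- Ch. 5 (chunk p0117): «These [Hypothesis 3.6.3 and Theorem* 2.6.2 for `ψ_v` at every `v`] have been established if `ψ = φ` is
generic and if `(G, ξ)` is realized as a pure inner twist of `G*`» (§1.7: «in which case the two hypotheses are verified»).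
[claim: KalethaMinguezShinWhite2014, under-review] -/
def Par_5_hypothesesVerified : Prop := D.IsPureInner → ∀ ψ : D.Param, D.IsGeneric ψ → D.HypLocal ψ ∧ D.HypLIR ψ

/-- **Theorem* 1.7.1** (§1.7, chunk p0046): «Let `E/F` be a quadratic extension of global fields and `κ ∈ {±1}`. Fix `χ_κ ∈ 𝒵^κ_E`.
Let `(G, ξ)` be an inner twist of `G* = U_{E/F}(N)`. Then there is a `G(𝔸_F)`-module isomorphism
`L²_disc(G(F)\G(𝔸_F)) ≃ ⊕_{ψ ∈ Ψ₂(G*, η_{χ_κ})} ⊕_{π ∈ Π_ψ(G, ξ, ε_ψ)} π`» — in multiplicities: `m_disc(π)` is the number of pairs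
`(ψ ∈ Ψ₂, member of Π_ψ(G,ξ,ε_ψ))` with representation `π`.  STARRED in print: proved there only in the scope of
`Theorem_1_7_1_genericPure`; the rest is deferred to the announced sequels [KMS_A], [KMS_B].
[claim: KalethaMinguezShinWhite2014, under-review] -/
def Theorem_1_7_1 : Prop :=
  ∀ π : (v : D.Place) → D.LocRep v,
    D.mdisc π = ∑ᶠ ψ : {ψ : D.Param // D.IsDiscrete ψ}, D.packetMultiplicity ψ.1 π

/-- **The unconditional part of Theorem* 1.7.1** (§1.7, chunk p0046: «The unconditional result of this paper towards the theorem, is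
a natural decomposition of `L²_disc(G(F)\G(𝔸_F))` according to the parameters `ψ ∈ Ψ(G*, η_{χ_κ})` only when `ψ` is generic and
`(G, ξ)` comes from a pure inner twist»): for `(G, ξ)` pure inner and `ψ` generic, the `ψ`-part is as in Theorem 5.0.5 — zero
unless `ψ ∈ Ψ₂`, and `⊕_{π ∈ Π_ψ(G,ξ,ε_ψ)} π` (here `ε_ψ = 1`) if `ψ ∈ Ψ₂`. [claim: KalethaMinguezShinWhite2014, under-review] -/
def Theorem_1_7_1_genericPure : Prop :=
  D.IsPureInner → ∀ ψ : D.Param, D.IsGeneric ψ →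
    (¬ D.IsDiscrete ψ → ∀ π, D.mdiscPsi ψ π = 0) ∧
      (D.IsDiscrete ψ → ∀ π, D.mdiscPsi ψ π = D.packetMultiplicity ψ π)

end GlobalDatum

/- Not typed (census): Remark 1.7.2 (an everywhere tempered discrete `π` occurs in the `ψ`-part of some GENERIC `ψ`) — needs the
tempered dual; the independence of `Π_ψ(G,ξ)`, `ε_ψ` from `κ`, `χ_κ`, `z` (§1.7, via Lemma 1.3.x and the product formula) — needs
the rigidifying data; both are prose remarks, not used by the socket. -/

end Literature.NumberTheory.Automorphic.KalethaMinguezShinWhite2014.MainTheorems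

end
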